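import Mathlib
import HarnessLib
import HarnessLib.Audit
import Summits.ABC.Statement
import Literature.NumberTheory.DiophantineGeometry.AbcWave0
import HarnessLib.Audit.Status.Attr

/-!
Route: CongruentialReceptacle

DORMANT since 2026-08-25T16:15:35Z (reconciler: no traction for 7.8 d (last activity item-evidence-added at 2026-08-17T19:19:04Z); parked, not closed — `ledger route dormant route-ABC-CongruentialReceptacle --off` to reactivate) — unstaffed, not closed; items shared with open routes are served there. `ledger route dormant <id> --off` reactivates.

THESIS (realises idea card ABC/ABC/congruential-receptacle-bogomolov). It suffices to show X =
BalancedFreySzpiro: for every κ > 0 and ε > 0 there is C with (abc)² ≤ C·rad(abc)^(6+ε) for all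
abc-triples with min(a,b) ≥ κ·c — Szpiro's exponent 6+ε for the Frey curves E_{a,b} (2⁸·Δ_min =
(abc)², N = rad(abc) under Serre's normalisation) on the compactly balanced cell, the cell where the
archimedean term log⁺|j_E| is O_κ(1). X is to be reached through a CONGRUENTIAL RECEPTACLE for the
arithmetic Bogomolov (Milnor–Wood) argument: a global-duality identity with FINITE coefficients ℤ/ℓⁿ
for a G_{ℚ,S}-module attached to E[ℓⁿ] (Poitou–Tate for ad⁰E[ℓⁿ], or mod-ℓⁿ Massey/Milnor invariants
of the primes dividing a, b, c) whose local term at a multiplicative prime p is v_p(Δ_min)·u_p + w_p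
with CANONICAL INTEGER weights of logarithmic size (c₁·log p ≤ u_p ≤ c₁′·log p, |w_p| ≤ c₂·log p,
terms at ℓ, 2, ∞ bounded by c₃, all uniform in E and ℓⁿ). Read at a modulus ℓⁿ exceeding the height,
the congruence is an identity in ℤ ("the integers are too small to wrap around":
CongruenceToEquality) and IS the inequality c₁·log|Δ_min| ≤ c₂·log N + c₃; crude constants give
polynomial abc c ≤ C·rad(abc)^A (= Literature.Barriers.ABC.BakerShapeBound 0 1; a milestone of the
mechanism, no longer an item of this route), the precision c₂/c₁ → 6 gives X. The mechanism is
archimedean-blind by construction (H¹(ℝ, finite module) is 2-torsion), so X → ABC is NOT glue: it is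
the archimedean partner, crux CompactBalanceTransfer (abc on compactly balanced triples for every κ
⟹ abc), open over ℚ and known only in bounded degree (Mochizuki 2010, Thm 2.1). The typed rank-2
crux TameLocalReceptacle (the tame-local face of the informal ReceptacleIdentity, whose kill test is
to be run first) feeds X through the glue TameLocalReceptacleGivesTarget, and the deciding theorem
reads closes : TameLocalReceptacle → TameLocalReceptacleGivesTarget → CompactBalanceTransfer →
Assembly → ABC := hA (hG hR) hT, the glue and the Assembly being PROVED items; AbelianWeightsVanish
(PROVED) records as a theorem that abelian (mod-m periodic) weights of size ≤ C·log p vanish at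
every prime below e^(m/4C), i.e. exactly in the range where congruence-to-equality operates, so only
non-abelian local terms can inhabit the receptacle.
Lean: ∀ κ : ℝ, 0 < κ → ∀ ε : ℝ, 0 < ε → ∃ C : ℝ, ∀ a b c : ℕ,
Literature.NumberTheory.DiophantineGeometry.IsABCTriple a b c → κ * (c : ℝ) ≤ (a : ℝ) → κ * (c : ℝ)
≤ (b : ℝ) → ((a * b * c : ℕ) : ℝ) ^ 2 ≤ C * ((Literature.NumberTheory.DiophantineGeometry.rad a b c
: ℕ) : ℝ) ^ (6 + ε)

Rationale: WHY THIS LINE. Bogomolov's Milnor–Wood proof of geometric Szpiro (BogomolovKatzarkovPantev2002,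
BraungardtKotschick2003; read against IUT in Mochizuki2016 §5) needs (a) a central extension whose
abelianisation counts total Dehn twisting and (b) a REAL-valued bounded-defect class turning
"product of local monodromies = central" into a linear inequality; over ℚ both die because
S-arithmetic/adelic groups carry no quasimorphisms (BurgerMonod1999, BurgerMonod2002; card
milnor-wood-adelization-nogo). The card keeps G_{ℚ,S} and discretises the VALUES: ℤ/ℓⁿ-valued global
words exist in abundance (Kummer/Artin and Poitou–Tate reciprocity; arithmetic
Chern–Simons/Dijkgraaf–Witten functionals Kim2020ArithChernSimonsI, ChungEtAl2017; mod-ℓ Milnor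
invariants of primes HiranoMorishita2019), and positivity is replaced by smallness: choose ℓⁿ above
the height, then a congruence between a-priori-small integers is an equality. Import: Galois
cohomology of finite G_{ℚ,S}-modules / arithmetic topology, aimed for the first time at a height
inequality. Catalogue used: reformulation (menu 5) + transplant with dictionary (cusp width n_i ↦
v_p(Δ_min); rotation number ↦ integer weight u_p; defect ≤ 1 per puncture ↦ |w_p| ≤ c₂·log p =
c₂·deg p; Euler characteristic term ↦ terms at ℓ, 2, ∞).
CONSISTENT SHAPE (fixes the inconsistency flagged by refuter-triage-5 on the card): bounded
sign-coherent weights would prove the FALSE ε-free bound Σ_p v_p(Δ) ≪ ω(N) (Mersenne triples), so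
the transplant of "defect ≤ 1 per puncture" must be "defect ≤ c₂·log p per prime" with weights u_p ≍
log p; then crude constants ⟹ log|Δ_min| ≤ (c₂/c₁)·log N + O(1) for all semistable Frey curves ⟹
polynomial abc c ≤ C·rad^A (milestone BakerShapeBound 0 1, not an item here); precision c₂/c₁ → 6 ⟹
Szpiro 6+ε for Frey curves ⟹ abc with 1+ε exactly where log⁺|j| = O(1): the compactly balanced cell
(Target). Balancing tricks do not help: Szpiro on θ-log-balanced Frey curves gives exponent
(6+ε)/(4+2θ) and the squaring pull-back of retired card balance-is-free returns endpoint 3/2 (its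
consequence (3)); compact balance is what is needed and its removal is crux CompactBalanceTransfer
(rank 4).
RANKED CRUXES. rank 2 ReceptacleIdentity [informal item; KILL TEST FIRST, as triage-5 demanded: at
ℓⁿ = 25, 49 on E_{1,8}, E_{5,27}, E_{1,80} decide whether ANY pairing on H¹(G_S, ad⁰E[ℓⁿ]) or Massey
triple ⟨χ_p, χ_p′, χ_p″⟩ has a multiplicative local term not of the form v_p(Δ)·λ(Frob_p) with λ
equidistributed; why it might fail: tame local duality terms are (v_p(Δ) mod ℓⁿ) × (Frobenius
datum), Frobenius-derived integers have size p, √p or are discrete logs, never ≍ log p, and the one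
known finite-coefficient identity touching the height, #Sel(ad⁰E)[ℓ^∞] = ℓ-part of the congruence
number ⊇ deg φ_E (Wiles1995, Diamond–Flach–Guo 2004), sees v_ℓ(deg φ), not its size]. rank 2 (typed,
added 2026-08-16 on the operator's target-unreachable hold) TameLocalReceptacle = the TAME-LOCAL,
typed face of ReceptacleIdentity's branch (i): for every prime power ℓⁿ an integer table t(p; v_p a,
v_p b, v_p c; a′, b′, c′ mod p) with windows c₁(v_p((abc)²) − 6 − ε)·log p ≤ t ≤ c₁′(…)·log p whose
sum over p ∣ abc is ≡ B (mod ℓⁿ), |B| ≤ c₃, on every κ-balanced triple prime to ℓ — LOCALITY (the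
term at p sees the triple only through E_{a,b}/ℚ_p) is the typed content refuter reviews r3/r4 found
missing (with triple-dependent weights the identity is just the Szpiro-shape bound); it is the
weakest tame-local form that yields the Target, via the glue TameLocalReceptacleGivesTarget :
TameLocalReceptacle → BalancedFreySzpiro (support; complete candidate proof attached as evidence, rc
0, standard axioms); why it might fail: residue-free tables are contradictory across the families
{squarefree}, {a = 2ⁿ}, {b = 2ⁿ}, {c = 2ⁿ}, and residues cannot detect a prime-power member at
primes where 2 is a primitive root (Hooley1976 ch. 3). rank 4 CompactBalanceTransfer (the
archimedean partner). (PolynomialABC = BakerShapeBound 0 1, the crude-constant milestone formerly at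
rank 3, was DROPPED 2026-08-16 as an unused crux: implied by ABC, it fed no hypothesis of `closes`;
it stays a support of route-ABC-FermatTwistHeights.) Support: AbelianWeightsVanish,
CongruenceToEquality (both PROVED 2026-08-16, Theorems/CongruentialReceptacle*.lean); glue
TameLocalReceptacleGivesTarget : TameLocalReceptacle → BalancedFreySzpiro (candidate proof on
stmt-ABC-14493). Target BalancedFreySzpiro (rank 0). Assembly : BalancedFreySzpiro →
CompactBalanceTransfer → ABC (a, b ≥ κc gives (abc)² ≥ κ⁴c⁶, so c ≤ C′·rad^(1+ε/6), then the
transfer) is PROVED (Theorems/CongruentialReceptacleAssembly.lean). DECIDING THEOREM (repaired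
2026-08-16, typed rank-2 crux now in its cone): closes : TameLocalReceptacle →
TameLocalReceptacleGivesTarget → CompactBalanceTransfer → Assembly → ABC := hA (hG hR) hT — its
non-crux hypotheses (glue, Assembly) are proved items, so the open leaves are exactly the cruxes
TameLocalReceptacle (rank 2) and CompactBalanceTransfer (rank 4).
KILL CRITERIA. (i) ReceptacleIdentity decided negatively in the triage form ⟹ `route close --reason
refuted:ReceptacleIdentity`, census = a no-go theorem for finite-coefficient receptacles that
upgrades milnor-wood-adelization-nogo (valuable negative knowledge: all three Bogomolov receptacles
dead). (ii) A refutation of CompactBalanceTransfer is not expected (it is implied by ABC); if it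
stalls as ABC-hard over ℚ, the route is RESTATED in bounded degree (below), not closed. (iii) The
polynomial-abc milestone (former item PolynomialABC) refuted would refute ABC itself — not
route-specific. (i′) TameLocalReceptacle refuted (a theorem ¬TameLocalReceptacle in Theorems) ⟹
branch (i) of the receptacle is dead for EVERY tame-local identity — the recorded no-go criterion
(i) asks for; the route then rests on branch (ii) (Massey/Rédei symbols of the prime support), which
has no typed content beyond the Target, so tenure either names one explicit branch-(ii) identity
with a ℤ-lift rule as a new typed crux within the grace window or closes
`refuted:TameLocalReceptacle`.
NOT DECOMPOSED YET. (Deliberately.) No split of ReceptacleIdentity into identity / defect bound /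
precision before the kill test. No bounded-degree restatement of Target and Transfer yet
(MochizukiGenEll2010 Thm 2.1, READ pp. 11–13: compactly bounded abc for points of degree ≤ d ⟺ full
Vojta in degree ≤ d, the proof passing through covers Y → X with d′ = d·deg(Y/X) and noncritical
Belyi maps — a citation would discharge the transfer but forces the receptacle over G_{K,S} for
[K:ℚ] ≤ d′ and the uniform-abc currency with |D_K|). No Frey-conductor currency
(conductorNorm/minimalDiscriminantNorm facts for freyCurve are unproved named facts; the elementary
currency (abc)², rad(abc) keeps the typed cone PROVED). One definition request filed: the
Poitou–Tate sum-of-local-pairings statement for finite G_{K,S}-modules, the vocabulary that types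
ReceptacleIdentity. No crude-constant variant of TameLocalReceptacle for ALL triples (which would
give polynomial abc by the same glue) — one typed receptacle at a time; tenure may file it if the
balanced one survives grounding.
CHEAPEST FALSIFIER. For TameLocalReceptacle: write out the one-page averaging argument that kills
residue-FREE tables (families {squarefree}, {a = 2ⁿ}, {b = 2ⁿ}, {c = 2ⁿ}: the three special families
force total slope −6c₁ against 0 on the generic one, the marginal laws of a, b, c matching well
enough — a Turán–Kubilius/Elliott-type mean-value estimate for log-bounded additive functions on
these sifted families, the only non-elementary input) and check whether it survives
residue-dependence at primes q ∣ b with 2 a primitive root (every residue is 2ⁿ for balanced n as b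
grows) — if it does, file ¬TameLocalReceptacle; for ReceptacleIdentity: the triage kill test at ℓⁿ ∈
{25, 49} on E_{1,8}, E_{5,27}, E_{1,80} (does ANY local pairing / Massey term at p ∥ N fail to be
(v_p(Δ) mod ℓⁿ)·λ(Frob_p) with λ equidistributed?).

Novelty: DELTA: a LOCAL, prime-by-prime decomposition of the Szpiro inequality into v_p(Δ_min)·(canonical
integer weight of size ≍ log p) plus O(log p) defects coming from a ℤ/ℓⁿ duality identity, read at a
modulus ℓⁿ above the height so that congruence = equality; the abelian case closed off by a theorem
(AbelianWeightsVanish); the archimedean partner isolated as the typed crux CompactBalanceTransfer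
with the bounded-degree escape MochizukiGenEll2010 Thm 2.1 documented. Nearest prior art actually
searched: (1) 'ℓ > height makes F_ℓ approximate ℤ': Mochizuki2016 §5 and IUTchI Rem 6.12.3(i),
DupuyHilado2020 (found by novelty-audit-4/triage-5 on the card); MochizukiGenEll2010 READ here (Thm
2.1; §3 'for any prime ℓ of the order of the height … the image contains SL₂(ℤ_ℓ)') — these use ℓ ≈
height for full Galois image / Θ-data, never for a congruence-to-equality reading of a duality
identity. (2) Milnor–Wood proof and its arithmetic no-go: BogomolovKatzarkovPantev2002
(arXiv:math/0106212, Rem. (iv) asks for the arithmetic analogue), BraungardtKotschick2003,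
BurgerMonod1999, BurgerMonod2002 (zbMATH 'Szpiro inequality symplectic' returns exactly the first
two). (3) Finite-coefficient global words from reciprocity: Kim2020ArithChernSimonsI (abstract read;
grep height/Szpiro/abc: 0 hits), ChungEtAl2017, Hirano–Kim–Morishita arXiv:2106.02308,
HiranoMorishita2019 — ℤ/n functionals aimed at L-functions and linking numbers, never at heights.
(4) The one finite-coefficient identity that touches t  [refs: math/0106212, 2106.02308, MochizukiGenEll2010, Mochizuki2016, DupuyHilado2020, BogomolovKatzarkovPantev2002, BraungardtKotschick2003, BurgerMonod1999, BurgerMonod2002, ChungEtAl2017, HiranoMorishita2019, Wiles1995, BombieriGubler2006, SilvermanAEC2009]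

Barriers (technique_class: galois-cohomology mod-ln-reciprocity bogomolov): technique_class: galois-cohomology mod-ln-reciprocity bogomolov
Literature.Barriers.ABC.IUTDisputedClaim: nothing is imported from IUT; 'ℓ above the height' is
motivation only, and the concrete shadow of the Scholze–Stix objection (the wild place / the
archimedean place absorbing everything) is made a decidable item: ReceptacleIdentity's kill test at
ℓⁿ = 25, 49 and the explicit admission that H¹(ℝ, finite) sees nothing, whence the separate typed
crux CompactBalanceTransfer; MochizukiGenEll2010 Thm 2.1 (refereed, outside the entry's narrowed
technique_class, scope_caveats (d)) is cited for the bounded-degree fallback, never assumed over ℚ.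
Literature.Barriers.ABC.BakerMethodBounds: no linear forms in logarithms anywhere in the line;
PolynomialABC is literally BakerShapeBound 0 1, the shape this barrier says logarithmic forms cannot
deliver (state of the art BakerShapeBound (1/3) 3 = stewart_yu), so reaching it certifies a
different technique class; on the compactly balanced cell no small linear form in logs exists at all
(|log(a/b)| ≍ 1), which is why the receptacle targets that cell.
Literature.Barriers.ABC.SzpiroEpsilonCannotBeDropped: respected and used as a consistency filter
(Masser1990): a receptacle with sign-coherent BOUNDED weights would give the false ε-free/ω(N)-type
bound, so weights ≍ log p and defects O(log p) per prime are required (CONSISTENT SHAPE in the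
rationale) and the Target keeps 6+ε.
Literature.Barriers.ABC.EpsilonCannotBeDropped: same filter on the ab

History (route lifecycle, newest last):
- 2026-08-16T03:28:56Z · rev 6: restated TameLocalReceptacleGivesTarget (stmt-ABC-14355) — route-choice follow-up: rev-5 glue support TameLocalReceptacleGivesTarget was rendered as a TODO comment (forward reference: supports are laid out in id order, (planner-rchoice-ABC-CongruentialReceptacle-tar-408cefad-0)
- 2026-08-25T16:15:35Z · DORMANT — reconciler: no traction for 7.8 d (last activity item-evidence-added at 2026-08-17T19:19:04Z); parked, not closed — `ledger route dormant route-ABC-Congruential (operator:999:3222485)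

sub-problem: ABC · status: dormant · opened planner-plancard-ABC-ABC-congruential-recepta-3e5f385e-0 2026-08-15T10:58:19Z · rev 12 · ledger route-ABC-CongruentialReceptacle
GENERATED by the gate from the ledger (D-0016/17). Provers cite these decls: `theorem foo : Summit.ABC.ABC.Theses.CongruentialReceptacle.<Decl> := …` in Summits/ABC/ABC/Theorems/<Name>.lean.
-/

namespace Summit.ABC.ABC.Theses.CongruentialReceptacle

open scoped BigOperators Topology Manifold Classical MeasureTheory ProbabilityTheory Matrix InnerProductSpace ComplexConjugate ContinuousMap
open Filter Set Function TopologicalSpace MeasureTheory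

attribute [summit_statement] _root_.ABC

open Literature.Abc

/-- item stmt-ABC-1723 · crux (kind.auto-crux: conjecture-grade) · rank 0 · open · by planner
why it might fail: abc-strength (⇔ c ≤ C·rad^{1+ε/6}) on a cell that carries quality-1.1757 triples (32+49=81, min/c = 0.395); nothing beyond StewartYu2001 / Pasten2024 Thm 1.4(2) is proved on it; reached only if ReceptacleIdentity survives AND its constants sharpen to c₂/c₁ → 6.
sources: Oesterle1988, SilvermanAEC2009, Frey1986, StewartYu2001, Pasten2024
[target] X = Szpiro's 6+ε for the Frey curves E_{a,b} of COMPACTLY BALANCED abc-triples (min(a,b) ≥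
κc for a fixed κ > 0), in elementary currency: 2⁸·Δ_min(E_{a,b}) = (abc)² and N = rad(abc) under
Serre's normalisation
(Literature.NumberTheory.EllipticCurves.minimalDiscriminantNorm_freyCurve_of_mod /
conductorNorm_freyCurve_of_mod, not needed as hypotheses here). On this cell log⁺|j_E| = O_κ(1), so
this is exactly what an archimedean-blind receptacle can deliver at precision c₂/c₁ → 6
(ReceptacleIdentity). Equivalent by elementary glue to abc with 1+ε on the same cell ((abc)² ≥
κ⁴c⁶). Why it might fail: it is abc-strength on a cell carrying quality-1.17 triples (32+49=81);
nothing beyond Stewart–Yu is known there. Sources: Oesterle1988 §3, SilvermanAEC2009 VIII.11,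
Frey1986. -/
@[route_item "route-ABC-CongruentialReceptacle", crux]
def BalancedFreySzpiro : Prop :=
  ∀ κ : ℝ, 0 < κ → ∀ ε : ℝ, 0 < ε → ∃ C : ℝ, ∀ a b c : ℕ, Literature.NumberTheory.DiophantineGeometry.IsABCTriple a b c → κ * (c : ℝ) ≤ (a : ℝ) → κ * (c : ℝ) ≤ (b : ℝ) → ((a * b * c : ℕ) : ℝ) ^ 2 ≤ C * ((Literature.NumberTheory.DiophantineGeometry.rad a b c : ℕ) : ℝ) ^ (6 + ε)

/-- item stmt-ABC-14354 · crux · rank 2 · open · by planner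
why it might fail: Residue-free tables are contradictory across the families {squarefree}, {a=2ⁿ}, {b=2ⁿ}, {c=2ⁿ} (forced slopes sum to −6c₁ vs 0); residues must detect a prime-power member additively — impossible at primes with 2 a primitive root (Artin/Hooley); tame data carry no log p (r3/r4).
sources: MilneADT2006, NeukirchSchmidtWingberg2008, BogomolovKatzarkovPantev2002, Hooley1976, LagariasSoundararajan2011, Masser1990
[crux] TAME-LOCAL RECEPTACLE — the typed face of ReceptacleIdentity (stmt-ABC-1813), branch (i): it
abstracts ANY ℤ/ℓⁿ identity whose term at a prime p ∣ abc depends on the triple only through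
E_{a,b}/ℚ_p, i.e. (p ∤ 2ℓ multiplicative) through E[ℓⁿ]|G_{ℚ_p} = (v_p(Δ) mod ℓⁿ, Tate-unit residue
mod p, split/non-split) — hence through the TAME DATUM D_p = (v_p a, v_p b, v_p c; a′ mod p, b′ mod
p, c′ mod p), x′ = p-free part of x (Poitou–Tate / Greenberg–Wiles sums over places for classes
functorial in E: Kummer classes of a, b, c, Δ, j and their local pairings). STATEMENT: for all κ, ε
> 0 there are c₁ > 0, c₁′, c₃, m₀ such that for every prime power ℓⁿ ≥ m₀ (ℓ ≥ 5 prime) there is an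
INTEGER table t(p; i,j,k; r,s,z) with c₁·(2(i+j+k) − 6 − ε)·log p ≤ t and |t| ≤ c₁′·(i+j+k+1)·log p,
such that every κ-balanced abc-triple with ℓ ∤ abc satisfies Σ_{p ∣ abc} t(p; D_p) ≡ B (mod ℓⁿ) for
some integer |B| ≤ c₃ (B = terms at ℓ, ∞ and the global side; 2⁸Δ_min = (abc)² costs O(1)). The
thesis shape v_p((abc)²)·u_p − w_p with c₁ log p ≤ u_p ≤ c₁′ log p, |w_p| ≤ (6+ε)c₁ log p is the
special case t = k·u − w; this is deliberately the WEAKEST tame-local form that still yields the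
Target (glue TameLoc -/
@[route_item "route-ABC-CongruentialReceptacle", crux]
def TameLocalReceptacle : Prop :=
  ∀ κ : ℝ, 0 < κ → ∀ ε : ℝ, 0 < ε → ∃ c₁ c₁' c₃ : ℝ, 0 < c₁ ∧ ∃ m₀ : ℕ, ∀ ℓ n : ℕ, ℓ.Prime → 5 ≤ ℓ → m₀ ≤ ℓ ^ n → ∃ t : ℕ → ℕ → ℕ → ℕ → ℕ → ℕ → ℕ → ℤ, (∀ p i j k r s z : ℕ, p.Prime → c₁ * (2 * ((i + j + k : ℕ) : ℝ) - 6 - ε) * Real.log p ≤ (t p i j k r s z : ℝ) ∧ |(t p i j k r s z : ℝ)| ≤ c₁' * (((i + j + k : ℕ) : ℝ) + 1) * Real.log p) ∧ ∀ a b c : ℕ, Literature.NumberTheory.DiophantineGeometry.IsABCTriple a b c → κ * (c : ℝ) ≤ (a : ℝ) → κ * (c : ℝ) ≤ (b : ℝ) → ¬ ℓ ∣ a * b * c → ∃ B : ℤ, |(B : ℝ)| ≤ c₃ ∧ (∑ p ∈ (a * b * c).primeFactors, t p (a.factorization p) (b.factorization p) (c.factorization p) (a / p ^ a.factorization p % p)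 (b / p ^ b.factorization p % p) (c / p ^ c.factorization p % p)) ≡ B [ZMOD ((ℓ ^ n : ℕ) : ℤ)]

-- item stmt-ABC-1813 · crux · rank 2 · open · by planner — informal only, no Lean statement yet:
--   [crux, rank 2 — KILL TEST FIRST; informal until the Poitou–Tate vocabulary lands (definition request
--   filed)] ReceptacleIdentity. For every prime power m = ℓⁿ (ℓ ≥ 5 prime, n ≥ 1) and every semistable
--   elliptic curve E/ℚ with full rational 2-torsion (Frey curves E_{a,b} in Serre normalisation: N =
--   rad(abc), 2⁸Δ_min = (abc)²) there is an identity in ℤ/m obtained from GLOBAL DUALITY for a finite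
--   G_{ℚ,S}-module built from E[m] — candidates: (i) Poitou–Tate, i.e. the vanishing of the sum over
--   places of the local Tate pairings H¹(ℚ_v, ad⁰E[m]) × H¹(ℚ_v, ad⁰E[m](1)) → ℤ/m on pairs of global
--   classes, e

/-- item stmt-ABC-1725 · crux · rank 4 · open · by planner
why it might fail: Open over ℚ: the one known transfer, MochizukiGenEll2010 Thm 2.1, runs through a cover Y→X and noncritical Belyi maps in degree d′ = d·deg(Y/X) > 1 (p. 12), never consuming compactly-bounded abc for ℚ-points only; cusp-preserving ℚ-correspondences of P¹∖{0,1,∞} never reach compact balance. abc-hard?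
sources: MochizukiGenEll2010, Elkies1991ABCMordell, BombieriGubler2006, Vojta1987
[crux, rank 4 — the archimedean partner] abc for compactly balanced triples (min(a,b) ≥ κc) for
EVERY κ > 0 implies abc. This is the over-ℚ shadow of MochizukiGenEll2010 Thm 2.1 ('abc for
Σ-supported compactly bounded subsets ⟺ Vojta/abc', READ pp. 11–13), whose proof leaves ℚ: it lifts
points along covers Y → X (degree d′ = d·deg(Y/X)) and moves them by noncritical Belyi maps, so it
needs the compactly-bounded hypothesis for algebraic points of bounded degree > 1. Over ℚ alone the
statement is OPEN: cusp-preserving Belyi self-maps of (P¹,{0,1,∞}) defined over ℚ scale the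
log-distance to a cusp by at most their degree, so bounded-degree correspondences reach log-balance
θ < 1 (retired card balance-is-free: one squaring gives θ = 1/2 for free) but never compact balance
(Lemma NA of card no-amplification-balance-census); and Szpiro on θ-balanced Frey curves only yields
abc-exponent (6+ε)/(4+2θ), whose pull-back iteration ends at 3/2. The mechanism of this route is
blind to the archimedean place (H¹(ℝ, finite) is 2-torsion), so some partner of this kind is
unavoidable; tenure fallback if this stalls: restate Target and this crux for points of P¹∖{0,1,∞}
of degree ≤ d′ (uniform-abc cur -/
@[route_item "route-ABC-CongruentialReceptacle", crux]
def CompactBalanceTransfer : Prop :=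
  (∀ κ : ℝ, 0 < κ → ∀ ε : ℝ, 0 < ε → ∃ C : ℝ, ∀ a b c : ℕ, Literature.NumberTheory.DiophantineGeometry.IsABCTriple a b c → κ * (c : ℝ) ≤ (a : ℝ) → κ * (c : ℝ) ≤ (b : ℝ) → (c : ℝ) < C * ((Literature.NumberTheory.DiophantineGeometry.rad a b c : ℕ) : ℝ) ^ (1 + ε)) → ABC

-- earlier TameLocalReceptacleGivesTarget (stmt-ABC-14355, replaced 2026-08-16T03:28:56Z -> stmt-ABC-14493): retired by None — TameLocalReceptacle → CongruenceToEquality → BalancedFreySzpiro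
/-- item stmt-ABC-14493 · support · rank 9 · closed · proved by Summit.ABC.ABC.Theorems.TameLocalReceptacleGivesTarget_proof @ 4507f6d6fa71 (prover) · by planner
sources: folklore
[support — GLUE, provable now, ~150–250 lines] TameLocalReceptacle → BalancedFreySzpiro: the
congruence-to-equality reading of a tame-local receptacle IS the Target; this is the item that makes
BalancedFreySzpiro reachable from a typed crux (operator hold 2026-08-16, route.target-unreachable).
(Rev-5 form `TameLocalReceptacle → CongruenceToEquality → BalancedFreySzpiro` was rendered as a TODO
because the gate lays out supports in id order and CongruenceToEquality (stmt-ABC-1727) comes later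
in the file; the antecedent is a two-line theorem, so it is now USED inside the proof instead of
assumed — cite/reprove CongruenceToEquality there.) PROOF PLAN: fix κ, ε and take c₁ > 0, c₁′, c₃,
m₀ from the receptacle; answer the Target with C := exp(c₃/c₁). Given a κ-balanced triple put N :=
abc (≥ 2) and Z := c₁′·(log N² + log rad N) — by the upper window |t| ≤ c₁′(k/2+1)·log p with k =
v_p(N²) ≥ 2 this bounds |Σ_{p∣N} t(p; D_p)| for EVERY modulus (the table depends on ℓⁿ, the bound
does not). Choose a prime ℓ > max(N, 4) (Nat.exists_infinite_primes; then 5 ≤ ℓ and ℓ ∤ N as 0 < N <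
ℓ) and n with ℓⁿ ≥ max(m₀, 2Z+1, 2c₃+1) (Nat.lt_pow_self / pow_unbounded_of_one_lt). Get t and B;
CongruenceToEq -/
@[route_item "route-ABC-CongruentialReceptacle", crux]
def TameLocalReceptacleGivesTarget : Prop :=
  TameLocalReceptacle → BalancedFreySzpiro

/-- item stmt-ABC-15117 · support · rank 9 · closed · proved by Summit.ABC.ABC.Theorems.quarterWindowGivesCrux_proof (prover) · by planner
[support — PROVED, candidate proof attached as evidence on stmt-ABC-1723 (Descent.lean:
crux_iff_quarter, rc 0, sorries 0, standard axioms); filed by crux-ideator 3 of stmt-ABC-1723, idea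
balance-window-descent] The crux BalancedFreySzpiro has a spurious quantifier: its single instance κ
= 1/4 (Szpiro 6+ε in elementary currency for triples with c ≤ 4·min(a,b)) implies it for every κ >
0. Mechanism: the squaring splitting a(a+2b) + b² = c² sends an abc triple of balance k = min/c to
one of balance min(k(2−k),(1−k)²) ≥ (3/2)k with top c² and radical ≤ 2c·rad(abc); with ε₀ = ε/(2+ε),
(1+ε₀)/(1−ε₀) = 1+ε, so abc(∀ε) descends from window [κ₁,1/2] (κ₁ ≤ 1/4) to [(2/3)κ₁,1/2]; induct on
κₙ = ¼(2/3)ⁿ and exchange currencies ((abc)² ≤ c⁶; (abc)² ≥ κ⁴c⁶). Use: (i) provers may prove the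
crux at κ = 1/4 only; (ii) TameLocalReceptacle (stmt-ABC-14354) is likewise only needed at κ = 1/4
(its glue is per-κ) — tenure may weaken it; (iii) the same maps certify numerically that any thin
balance window (e.g. the isosceles corner a/b ≥ 0.984) carries the crux (card
balance-window-descent). Sources: folklore (polynomial identity); closed cards balance-is-free,
no-amplification-balance-census (Lemma NA) -/
@[route_item "route-ABC-CongruentialReceptacle"]
def QuarterWindowGivesCrux : Prop :=
  (∀ ε : ℝ, 0 < ε → ∃ C : ℝ, ∀ a b c : ℕ, Literature.NumberTheory.DiophantineGeometry.IsABCTriple a b c → (1 / 4 : ℝ) * (c : ℝ) ≤ (a : ℝ) → (1 / 4 : ℝ) * (c : ℝ) ≤ (b : ℝ) → ((a * b * c : ℕ) : ℝ) ^ 2 ≤ C * ((Literature.NumberTheory.DiophantineGeometry.rad a b c : ℕ) : ℝ) ^ (6 + ε)) → BalancedFreySzpiro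

/-- item stmt-ABC-1726 · support · rank 9 · closed · proved by Summit.ABC.ABC.Theorems.abelianWeightsVanish_proof @ 59ef317bb03a (prover) · by planner
sources: Neukirch1986
[support — the card's 'abelian candidates eliminated' as a theorem; Lean-now] If integer weights
u(q) on primes have logarithmic size |u(q)| ≤ C·log q and the completely additive function f(n) =
Σ_q v_q(n)·u(q) is m-PERIODIC on the units mod m (which is what 'the identity comes from abelian
reciprocity over ℚ with modulus m' means: Artin/Kummer local terms at p depend on Frob_p ∈ (ℤ/m)^×
only), then for m ≥ m₀(C) every prime p ∤ m with C·log p ≤ m/4 has u(p) = 0 — i.e. abelian weights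
vanish on exactly the range of primes where congruence-to-equality operates (modulus above C·log p).
Proof (planner NOTES): for k ≥ 1 let n_k = p^k mod m ∈ [1, m); periodicity gives k·u(p) = f(p^k) ≡
f(n_k) (mod m) with |f(n_k)| ≤ C·log n_k < C·log m =: T; if u(p) = ±d ≠ 0 take k* = ⌊T/d⌋ + 1, so T
< k*·d ≤ T + d, and any r ≡ k*·u(p) (mod m) with |r| < T has 0 < |k*·u(p) − r| < 2T + d ≤ m once
C·log m ≤ m/4 − 1 and d ≤ C·log p ≤ m/4 — contradiction. No Dirichlet/Linnik needed. Consequence for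
the route: only NON-abelian local terms (Poitou–Tate for ad⁰E[ℓⁿ], Massey products) can inhabit
ReceptacleIdentity. Source: the card's negative computations (Artin reciprocity for the Kummer class
of 1/j gives di -/
@[route_item "route-ABC-CongruentialReceptacle"]
def AbelianWeightsVanish : Prop :=
  ∀ C : ℝ, ∃ m₀ : ℕ, ∀ m : ℕ, m₀ ≤ m → ∀ u : ℕ → ℤ, (∀ q : ℕ, q.Prime → |(u q : ℝ)| ≤ C * Real.log q) → (∀ a b : ℕ, a.Coprime m → b.Coprime m → a ≡ b [MOD m] → (∑ q ∈ a.primeFactors, (a.factorization q : ℤ) * u q) ≡ (∑ q ∈ b.primeFactors, (b.factorization q : ℤ) * u q) [ZMOD m]) → ∀ p : ℕ, p.Prime → p.Coprime m → C * Real.log p ≤ (m : ℝ) / 4 → u p = 0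

/-- item stmt-ABC-1727 · support · rank 9 · closed · proved by Summit.ABC.ABC.Theorems.congruenceToEquality_proof @ 74ce86f01d4a (prover) · by planner
sources: folklore
[support — trivial; the route's namesake and its ONLY use of the modulus] two integers congruent mod
m and both of absolute value < m/2 are equal. In the mechanism x = Σ_p v_p(Δ_min)·u_p (known a
priori to be ≤ c₁′·log|Δ_min|) and y = Σ_p w_p + B (≤ c₂·log N + c₃); ℓⁿ = m is free, chosen >
2·max, which is why the constants must be uniform in ℓⁿ. [folklore] -/
@[route_item "route-ABC-CongruentialReceptacle"]
def CongruenceToEquality : Prop :=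
  ∀ m x y : ℤ, x ≡ y [ZMOD m] → 2 * |x| < m → 2 * |y| < m → x = y

/-- item stmt-ABC-1728 · assembly · rank 1 · closed · proved by Summit.ABC.ABC.Theorems.congruentialReceptacle_assembly_proof @ 02436f954f72 (prover) · by planner
sources: folklore
[assembly] From BalancedFreySzpiro derive the hypothesis of CompactBalanceTransfer (for a, b ≥ κc:
(abc)² ≥ κ⁴·c⁶, so (abc)² ≤ C·rad^{6+ε} gives c ≤ (C/κ⁴)^{1/6}·rad^{1+ε/6} < C′·rad^{1+ε} using rad
≥ 1), then apply the transfer. Elementary real-power bookkeeping (Real.rpow monotonicity); no named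
facts. ReceptacleIdentity (informal crux, rank 2) is the route's bet on HOW BalancedFreySzpiro gets
proved and is not a hypothesis here. -/
@[route_item "route-ABC-CongruentialReceptacle", crux]
def Assembly : Prop :=
  BalancedFreySzpiro → CompactBalanceTransfer → ABC

/-! D-0027 §2.1 — DECIDING THEOREM (planner-authored via `route open/edit --closes-file`; by planner-rrepair-ABC-CongruentialReceptacle-unu-6c92f8a7-0 2026-08-16T07:26:21Z):
its hypotheses are this route's items and its conclusion the sub-problem Statement (glue_lint), and it elaborates with this file. -/

@[closes "route-ABC-CongruentialReceptacle"] theorem closes (hR : TameLocalReceptacle) (hG : TameLocalReceptacleGivesTarget) (hT : CompactBalanceTransfer) (hA : Assembly) : _root_.ABC :=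
  -- The rank-2 crux TameLocalReceptacle yields the Target X = BalancedFreySzpiro through the glue
  -- TameLocalReceptacleGivesTarget (proved, Theorems/CongruentialReceptacleTameLocalReceptacleGivesTarget.lean);
  -- the Assembly item (proved, Theorems/CongruentialReceptacleAssembly.lean: a, b ≥ κc ⇒ (abc)² ≥ κ⁴c⁶, so
  -- (abc)² ≤ C·rad^(6+ε) ⇒ c < C′·rad^(1+ε/6)) feeds X to the archimedean partner CompactBalanceTransfer.
  hA (hG hR) hT

end Summit.ABC.ABC.Theses.CongruentialReceptacle
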